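import Literature.MathematicalPhysics.PowerSystems.QuadraticDroopDynamicShuntLoads
import HarnessLib

/-!
# Quadratic droop control: POWER SHARING (Simpson-Porco–Dörfler–Bullo 2017, §4.2 Theorem 4.2) —
# the linear response `Q_I = K_I(B_II + K_I)⁻¹B_ILB_red⁻¹Q_L` of the inverter injections to small
# constant-power demands, and the high-gain (distance-based) limit

Topic `Literature/MathematicalPhysics/PowerSystems` (LADDER-GRIDFUSION rung G3.b, quadratic-droop lineage;
seat gridfusion-lit-2, g15).  Sixth file on [SimpsonporcoDorflerBullo2017] = IEEE TAC 62 (2017)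
1239–1253 = arXiv:1507.00431 (held text read on the page this session: §4.2 p0014 L14–L73, proof
p0014 L75 – p0015 L50, §7 Lemma 7.3 and its proof p0019 L72–L80).  Companions:
`QuadraticDroopVoltageStabilization.lean` (model (3.3), `W₁`, `W₂`, `E_L*`, Proposition 7.2 (ii):
`W1_mulVec_one`, `W2_mulVec_one`), `QuadraticDroopZIPLoads.lean` (Theorem 3.4: the solution map
`zipVoltage`, `hasFDerivAt_zipVoltage`), `QuadraticDroopDynamicShuntLoads.lean` (`ziVoltage_zero_zero`,
`Qsc_zero_zero`).

THE PRINTED STATEMENTS (p0014).  Standing assumptions of §4.2 (L20): constant-power loads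
`Q_L(E_L) = Q_L` and uniform inverter set points `E_I* = E_N𝟙_m`, `E_N > 0`; «the results of Theorem 3.4
simplify to yield the approximate load voltages `E_L ≃ E_N(𝟙_n − B_red⁻¹Q_L/E_N²)` (4.7)».
«Definition 1 (Differential Effective Reactance). Let `E_i^oc` be the open-circuit voltage at load
`i ∈ L`. The differential effective reactance `X^eff_ij` between loads `i, j ∈ L` is the voltage
difference `E_i − E_i^oc` measured at load `i` when a unit current is extracted at load `j` with all
other current injections zero.»  «Theorem 4.2 (Power Sharing). Consider the closed-loop system (3.3)
with the approximate load voltages (4.7). Then the inverter reactive power injections `Q_I ∈ ℝ^m` are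
given by `Q_I = K_I(B_II + K_I)⁻¹B_ILB_red⁻¹Q_L` (4.8). Moreover, the following special cases hold:
1) Distance-Based Power Sharing: In the high-gain limit where `K_i → −∞` for each inverter `i ∈ I`,
it holds that `Q_i = −Σ_{k∈L}(1/X_ik)Σ_{j∈L}X^eff_kjQ_j` (4.9) …; 2) Proportional Power Sharing: In the
low-gain limit where `K_i → 0⁻` …, `Q_i = (K_i/Σ_iK_i)Q_total` (4.10).»  THE PRINTED PROOF (p0014 L75 –
p0015 L50): in steady state `Q_I = K_I[E_I](E_I − E_N𝟙_m)` (Theorem 3.1 gives `E_I` in terms of `E_L`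
by (3.8)); substituting (4.7) into (3.8), `E_I = E_N𝟙_m + A₁Q_L` with `A₁ = (1/E_N)(B_II + K_I)⁻¹B_ILB_red⁻¹`
(«`W₃` is row-stochastic»); «we linearize around the open-circuit operating condition (`E_I = E_N𝟙_m`,
`Q_I = 0_m`) … `Q_I = E_NK_I(E_I − E_N𝟙_m)`, which after substituting yields (4.8)»; for 1): with
`B_red,ε = B_LL − B_LI(B_II + εK_I)⁻¹B_IL`, `S_ε = εK_I(B_II + εK_I)⁻¹B_ILB_red,ε⁻¹` (`S_1` = (4.8)),
«`lim_{ε→∞} B_red,ε = B_LL` and `lim_{ε→∞} εK_I(B_II + εK_I)⁻¹ = I_m`. It follows that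
`lim_{ε→∞} S_ε = B_ILB_LL⁻¹`. Applying Lemma 7.3 then leads to the first statement»; Lemma 7.3
(p0019 L72–L80): «`−(B_ILB_LL⁻¹)_ij = Σ_{k∈L} X^eff_kj/X_ik`», proof: «from the current balance equations
`−jI_L = B_LLE_L + B_LIE_I` … `E_L^oc = −B_LL⁻¹B_LIE_I` … `E_L − E_L^oc = −jB_LL⁻¹I_L`, and it follows that
`X^eff = −B_LL⁻¹` … for `i ∈ L`, `j ∈ I`, `{i,j} ∈ ℰ`, `1/(B_LI)_ij = X_ij` by definition».

WHAT THIS FILE PROVES (0 named facts).  The print's «≃» / «linearize around the open-circuit operating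
condition» are typed as FRÉCHET DERIVATIVES AT `Q_L = 0` of the exact solution branch of Theorem 3.4
(constant-power loads): `Q_L ↦ E_L(Q_L) := zipVoltage 0 0 Q_L`, `E_I(Q_L) := W₂(E_L(Q_L), E_I*)`,
`Q_I(Q_L) := K_I[E_I](E_I − E_I*)`.
* §1 `invInjection` (`Q_i = K_iE_i(E_i − E_i*)`, = the network injection `−E_i(BE)_i` at an equilibrium:
  `invInjection_eq_reactiveInjection`); uniform set points: `E_L* = E_N𝟙` (`ELstar_eq_const`),
  `W₂(E_N𝟙, E_N𝟙) = E_N𝟙` (`invVoltage_const`), `E_L^{ZI}(0,0) = E_N𝟙` (`ziVoltage_zero_zero_const`), and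
  the open-circuit operating condition `E_L(0) = E_N𝟙`, `E_I(0) = E_N𝟙`, `Q_I(0) = 0` (`openCircuit_uniform`).
* §2 (4.7) as **`hasFDerivAt_loadVoltage_uniform`**: `DE_L(0) = −E_N⁻¹B_red⁻¹` (from Theorem 3.4's
  `DE_L(0) = −[E^ZI]Q_sc⁻¹` with `E^ZI = E_N𝟙`, `Q_sc = E_N²B_red`); `W₂` is affine
  (`hasFDerivAt_invVoltage`: `DW₂ = −(B_II + K_I)⁻¹B_IL` everywhere); **`hasFDerivAt_invVoltage_uniform`**:
  `DE_I(0) = A₁ = E_N⁻¹(B_II + K_I)⁻¹B_ILB_red⁻¹`.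
* §3 `shareMatrix = S_1 = K_I(B_II + K_I)⁻¹B_ILB_red⁻¹`; **`theorem_4_2_powerSharing`** (4.8):
  `Q_L ↦ Q_I(Q_L)` has Fréchet derivative `S_1` at `0` (the `E_N` of `E_NK_I` and the `1/E_N` of `A₁`
  cancel), i.e. `Q_I(Q_L) = S_1Q_L + o(Q_L)`; `fderiv_invInjection_zero` (`D(Q_I)(0)q = S_1q`);
  **`theorem_4_2_powerSharing_of_network`** (hypotheses from branch data: Lemma 7.1, Proposition 7.2).
* §4 the gain-scaled family `BredGain ε = B_red,ε`, `shareMatrixGain ε = S_ε` (`BredGain_one`,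
  `shareMatrixGain_one`: `S_1` = (4.8)); `inv_BII_add_smul` (`(B_II + εK_I)⁻¹ = ε⁻¹(ε⁻¹B_II + K_I)⁻¹`),
  `shareMatrixGain_eq_rescaled` (`S_ε = K_I(ε⁻¹B_II + K_I)⁻¹B_IL(B_LL − ε⁻¹B_LI(ε⁻¹B_II + K_I)⁻¹B_IL)⁻¹`),
  `tendsto_rescaled_atTop` (continuity of the matrix inverse at `K_I` and at `B_LL`, `ε⁻¹ → 0`) and
  **`tendsto_shareMatrixGain_atTop`**: `K_i ≠ 0`, `B_LL` invertible ⇒ `S_ε → B_ILB_LL⁻¹` as `ε → ∞`;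
  `Xeff := −B_LL⁻¹` with Definition 1 as the theorem **`Xeff_spec`** (for the linear current-balance
  model `ι_L = B_LLE_L + B_LIE_I` of the load buses with the inverter voltages held fixed: extracting a
  unit current at load `j` moves the load voltages from their open-circuit values by the column
  `X^eff_{·j}`), **`lemma_7_3`** (`−(B_ILB_LL⁻¹)_ij = Σ_k B_ik X^eff_kj`, `B_ik = 1/X_ik` on branches and `0`
  otherwise), and the distance-based form of the limit entrywise / applied to a demand vector:
  **`tendsto_shareMatrixGain_atTop_distance`** (`(S_ε)_ij → −Σ_k B_ikX^eff_kj`),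
  `tendsto_shareMatrixGain_mulVec_atTop` (`(S_εQ_L)_i → −Σ_k B_ik Σ_j X^eff_kj Q_j`, eq. (4.9)).

THREE COLUMNS / NOT CLAIMED.  Statements about the MODEL (3.3) with constant-power loads and uniform
set points.  (4.8) is the DERIVATIVE of the exact injection map at `Q_L = 0` (the print's linearisation
«≃»), not an identity for finite `Q_L`; the high-gain limit is the limit of the MATRICES `S_ε` (the
print's object), no statement about equilibria or stability for large `|K|` is made; the LOW-GAIN limit
2) (4.10) (Laurent expansion of `B_red,ε⁻¹` at the simple pole `ε = 0`, [PS-GWS:93]) is NOT typed; the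
«`W₃` row-stochastic» sentence is bypassed (we differentiate the exact branch instead of substituting the
approximation).  Nothing here says a microgrid shares power in any particular way.

## Mathlib / tree search

Tree: companions as listed (BY NAME).  Mathlib: `HasFDerivAt.comp`, `hasFDerivAt_pi`,
`ContinuousLinearMap.hasFDerivAt`, `Matrix.toLin'_apply`, `Matrix.smul_one_eq_diagonal`,
`continuousAt_matrix_inv` + `Ring.inverse_eq_inv'` + `continuousAt_inv₀` (as in the companion's
`continuousAt_jacLL_inv`), `tendsto_inv_atTop_zero`, `Matrix.inv_eq_right_inv`.

## References

* J. W. Simpson-Porco, F. Dörfler, F. Bullo, *Voltage stabilization in microgrids via quadratic droop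
  control*, IEEE Trans. Automat. Control 62 (2017) 1239–1253 = arXiv:1507.00431: §4.2 eq. (4.7),
  Definition 1, Theorem 4.2 (p0014 L14–L73), its proof (p0014 L75 – p0015 L50), §7 Lemma 7.3 (p0019
  L72–L80). [SimpsonporcoDorflerBullo2017]

AI-produced formalisation (LADDER-GRIDFUSION seat gridfusion-lit-2 g15, 2026-08-28).
-/

noncomputable section

open Finset Filter Set
open scoped Matrix BigOperators Topology

namespace Literature.MathematicalPhysics.PowerSystems

open _root_.Matrix Literature.LinearAlgebra.Matrix

namespace QuadDroopNetwork

variable {n m : ℕ} (W : QuadDroopNetwork n m)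

/-- Invertibility of `M` from positive definiteness of `−M` (restated; private in the companions).
[folklore] -/
private theorem isUnit_det_of_posDef_neg₄ {ι : Type*} [Fintype ι] [DecidableEq ι] {M : Matrix ι ι ℝ}
    (h : (-M).PosDef) : IsUnit M.det := by
  have h1 : IsUnit (-M).det := (Matrix.isUnit_iff_isUnit_det _).1 h.isUnit
  rw [Matrix.det_neg, isUnit_iff_ne_zero, mul_ne_zero_iff] at h1
  exact isUnit_iff_ne_zero.2 h1.2

/-- `diagonal 0 = 0` with the `Pi` zero literal. [folklore] -/
private theorem diagonal_zero₄ {ι : Type*} [DecidableEq ι] :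
    (diagonal (0 : ι → ℝ) : Matrix ι ι ℝ) = 0 := diagonal_zero

/-! ## §1 Inverter injections; uniform set points and the open-circuit operating condition -/

/-- **The inverter reactive power injections under quadratic droop**: `Q_i = K_iE_i(E_i − E_i*)`
(the control law (3.2) `u_i = K_iE_i(E_i − E_i*)`; in vector form `Q_I = K_I[E_I](E_I − E_I*)`).
[cite: SimpsonporcoDorflerBullo2017, §3.1 eq. (3.2) and proof of Theorem 4.2 («in steady-state, the inverter reactive power injections are given by `Q_I = K_I[E_I](E_I − E_N𝟙_m)`», p0014 L75 – p0015 L2)] -/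
def invInjection (E : Fin n ⊕ Fin m → ℝ) (i : Fin m) : ℝ :=
  W.K i * E (Sum.inr i) * (E (Sum.inr i) - W.Estar i)

variable {W}

/-- At an equilibrium of the closed loop (3.3) the droop injection IS the network injection
`Q_e,i(E) = −E_i(BE)_i` (the inverter rows of (3.3) read `0 = K_iE_i(E_i − E_i*) + E_i(BE)_i`).
[cite: SimpsonporcoDorflerBullo2017, §3.1 eq. (3.3) (inverter rows) with §2.1 eq. (2.4)] -/
theorem invInjection_eq_reactiveInjection {QL : Fin n → ℝ → ℝ} {E : Fin n ⊕ Fin m → ℝ}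
    (hE : W.IsEquilibrium QL E) (i : Fin m) :
    W.invInjection E i = W.reactiveInjection E (Sum.inr i) := by
  have h := congrFun hE (Sum.inr i)
  simp only [closedLoop, Sum.elim_inr, Pi.zero_apply] at h
  rw [invInjection, reactiveInjection]
  linear_combination h

/-- **Uniform set points give a flat open-circuit profile**: `E_I* = E_N𝟙_m ⇒ E_L* = W₁E_I* = E_N𝟙_n`
(`W₁` row-stochastic, Proposition 7.2 (ii)). [cite: SimpsonporcoDorflerBullo2017, §4.2 eq. (4.7) («`E_L ≃ E_N(𝟙_n − …)`») with §7 Proposition 7.2 (ii)] -/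
theorem ELstar_eq_const (hrow : ∀ k, ∑ k', W.B k k' = 0) (hU : IsUnit W.BIIK.det)
    (hred : IsUnit W.Bred.det) {EN : ℝ} (hEs : W.Estar = fun _ => EN) :
    W.ELstar = fun _ => EN := by
  have h1 := W1_mulVec_one hrow hU hred
  have hc : (fun _ : Fin m => EN) = EN • fun _ => (1 : ℝ) := by
    funext i; simp
  rw [ELstar, hEs, hc, Matrix.mulVec_smul, h1]
  funext l; simp

/-- `W₂(E_N𝟙_n, E_N𝟙_m) = E_N𝟙_m` (`W₂` row-stochastic, Proposition 7.2 (ii)): with uniform set points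
and flat load voltages the inverter voltages are flat. [cite: SimpsonporcoDorflerBullo2017, proof of Theorem 4.2 («`E_I = E_N·W₃𝟙_m + A₁Q_L`, where `W₃` is row-stochastic», p0015 L6–L8) with Proposition 7.2 (ii)] -/
theorem invVoltage_const (hrow : ∀ k, ∑ k', W.B k k' = 0) (hU : IsUnit W.BIIK.det) {EN : ℝ}
    (hEs : W.Estar = fun _ => EN) : W.invVoltage (fun _ => EN) = fun _ => EN := by
  have h1 := W2_mulVec_one hrow hU
  have hc : Sum.elim (fun _ : Fin n => EN) W.Estar = EN • fun _ : Fin n ⊕ Fin m => (1 : ℝ) := by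
    funext k; cases k <;> simp [hEs]
  rw [invVoltage_eq_W2_mulVec, hc, Matrix.mulVec_smul, h1]
  funext i; simp

/-- With constant-power loads `E_L^{ZI}(0, 0) = E_L* = E_N𝟙_n`. [cite: SimpsonporcoDorflerBullo2017, §4.2 eq. (4.7)] -/
theorem ziVoltage_zero_zero_const (hrow : ∀ k, ∑ k', W.B k k' = 0) (hU : IsUnit W.BIIK.det)
    (hred : IsUnit W.Bred.det) {EN : ℝ} (hEs : W.Estar = fun _ => EN) :
    W.ziVoltage 0 0 = fun _ => EN := by
  rw [ziVoltage_zero_zero hred, ELstar_eq_const hrow hU hred hEs]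

/-- **The open-circuit operating condition**: at `Q_L = 0` the solution branch of Theorem 3.4 with
constant-power loads sits at `E_L = E_N𝟙_n`, `E_I = E_N𝟙_m`, `Q_I = 0_m`.
[cite: SimpsonporcoDorflerBullo2017, proof of Theorem 4.2 («we linearize (InvInjections) around the open-circuit operating condition (`E_I = E_N𝟙_m`, `Q_I = 0_m`)», p0015 L12–L13)] -/
theorem openCircuit_uniform (hrow : ∀ k, ∑ k', W.B k k' = 0) (hU : IsUnit W.BIIK.det)
    (hred : IsUnit W.Bred.det) {EN : ℝ} (hEs : W.Estar = fun _ => EN) (hEN : EN ≠ 0) :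
    W.zipVoltage 0 0 0 = (fun _ => EN) ∧
      W.invVoltage (W.zipVoltage 0 0 0) = (fun _ => EN) ∧
      ∀ i, W.invInjection (W.zipState 0 0 0) i = 0 := by
  have hU' : IsUnit (W.Bred + diagonal (0 : Fin n → ℝ)).det := by rwa [diagonal_zero₄, add_zero]
  have hEZI := ziVoltage_zero_zero_const hrow hU hred hEs
  have hE : ∀ l, W.ziVoltage 0 0 l ≠ 0 := fun l => by rw [hEZI]; exact hEN
  obtain ⟨h0, -, -, -⟩ := W.theorem_3_4_implicitFunction hU' hE (N := 1)
  have hL : W.zipVoltage 0 0 0 = fun _ => EN := by rw [h0, hEZI]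
  have hI : W.invVoltage (W.zipVoltage 0 0 0) = fun _ => EN := by
    rw [hL, invVoltage_const hrow hU hEs]
  refine ⟨hL, hI, fun i => ?_⟩
  have h2 : W.zipState 0 0 0 (Sum.inr i) = EN := by
    rw [zipState, liftState, Sum.elim_inr, hI]
  rw [invInjection, h2, hEs, sub_self, mul_zero]

/-! ## §2 (4.7) and `A₁`: the derivatives of the load and inverter voltages at `Q_L = 0` -/

/-- **(4.7) `E_L ≃ E_N(𝟙_n − B_red⁻¹Q_L/E_N²)`** as the derivative of the exact branch: with
constant-power loads and uniform set points `E_N ≠ 0`, `Q_L ↦ E_L(Q_L)` (Theorem 3.4's solution map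
at `b_shunt = I_shunt = 0`) has Fréchet derivative `−E_N⁻¹B_red⁻¹` at `0` (Theorem 3.4:
`DE_L(0) = −[E^ZI]Q_sc⁻¹`, here `E^ZI = E_N𝟙`, `Q_sc = E_N²B_red`).
[cite: SimpsonporcoDorflerBullo2017, §4.2 eq. (4.7) («the results of Theorem 3.4 simplify to yield the approximate load voltages», p0014 L20–L24)] -/
theorem hasFDerivAt_loadVoltage_uniform (hrow : ∀ k, ∑ k', W.B k k' = 0) (hU : IsUnit W.BIIK.det)
    (hred : IsUnit W.Bred.det) {EN : ℝ} (hEs : W.Estar = fun _ => EN) (hEN : EN ≠ 0) :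
    HasFDerivAt (W.zipVoltage 0 0)
      (-(LinearMap.toContinuousLinearMap (Matrix.toLin' (EN⁻¹ • W.Bred⁻¹)))) 0 := by
  have hU' : IsUnit (W.Bred + diagonal (0 : Fin n → ℝ)).det := by rwa [diagonal_zero₄, add_zero]
  have hEZI := ziVoltage_zero_zero_const hrow hU hred hEs
  have hE : ∀ l, W.ziVoltage 0 0 l ≠ 0 := fun l => by rw [hEZI]; exact hEN
  have h := W.hasFDerivAt_zipVoltage hU' hE
  have hdiag : diagonal (fun _ : Fin n => EN) = EN • (1 : Matrix (Fin n) (Fin n) ℝ) :=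
    (smul_one_eq_diagonal EN).symm
  have hQ : W.Qsc 0 0 = (EN ^ 2) • W.Bred := by
    rw [Qsc_zero_zero hred, ELstar_eq_const hrow hU hred hEs, hdiag, Matrix.smul_mul, Matrix.mul_smul,
      Matrix.one_mul, Matrix.mul_one, smul_smul, pow_two]
  have hQinv : (W.Qsc 0 0)⁻¹ = (EN ^ 2)⁻¹ • W.Bred⁻¹ := by
    rw [hQ]
    refine inv_eq_right_inv ?_
    rw [Matrix.smul_mul, Matrix.mul_smul, smul_smul, mul_nonsing_inv _ hred, mul_inv_cancel₀
      (pow_ne_zero 2 hEN), one_smul]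
  have hmat : diagonal (W.ziVoltage 0 0) * (W.Qsc 0 0)⁻¹ = EN⁻¹ • W.Bred⁻¹ := by
    rw [hEZI, hdiag, hQinv, Matrix.smul_mul, Matrix.one_mul, smul_smul]
    congr 1
    field_simp
  rw [hmat] at h
  exact h

variable (W) in
/-- `W₂(·, E_I*)` is affine: `E_L ↦ (B_II + K_I)⁻¹(K_IE_I* − B_ILE_L)` has derivative
`−(B_II + K_I)⁻¹B_IL` everywhere. [cite: SimpsonporcoDorflerBullo2017, §3.2 Theorem 3.1 eq. (3.8) and proof of Theorem 4.2 («substituting … into (3.8)», p0015 L6)] -/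
theorem hasFDerivAt_invVoltage (EL : Fin n → ℝ) :
    HasFDerivAt W.invVoltage
      (-(LinearMap.toContinuousLinearMap (Matrix.toLin' (W.BIIK⁻¹ * W.BIL)))) EL := by
  set T : (Fin n → ℝ) →L[ℝ] (Fin m → ℝ) :=
    LinearMap.toContinuousLinearMap (Matrix.toLin' (W.BIIK⁻¹ * W.BIL)) with hT
  have h := (T.hasFDerivAt (x := EL)).const_sub (W.BIIK⁻¹ *ᵥ (diagonal W.K *ᵥ W.Estar))
  refine h.congr_of_eventuallyEq (Eventually.of_forall fun EL' => ?_)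
  simp [hT, invVoltage, Matrix.toLin'_apply, Matrix.mulVec_sub, Matrix.mulVec_mulVec]

/-- **`E_I = E_N𝟙_m + A₁Q_L` to first order, `A₁ = E_N⁻¹(B_II + K_I)⁻¹B_ILB_red⁻¹`**: the derivative
at `Q_L = 0` of `Q_L ↦ E_I(Q_L) = W₂(E_L(Q_L), E_I*)`.
[cite: SimpsonporcoDorflerBullo2017, proof of Theorem 4.2 eqs. (InvVoltagesConstantP)/(A1) («`E_I = E_N𝟙_m + A₁Q_L`, where `A₁ ≜ (1/E_N)(B_II+K_I)⁻¹B_ILB_red⁻¹`», p0015 L6–L11)] -/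
theorem hasFDerivAt_invVoltage_uniform (hrow : ∀ k, ∑ k', W.B k k' = 0) (hU : IsUnit W.BIIK.det)
    (hred : IsUnit W.Bred.det) {EN : ℝ} (hEs : W.Estar = fun _ => EN) (hEN : EN ≠ 0) :
    HasFDerivAt (fun Q => W.invVoltage (W.zipVoltage 0 0 Q))
      (LinearMap.toContinuousLinearMap
        (Matrix.toLin' (EN⁻¹ • (W.BIIK⁻¹ * W.BIL * W.Bred⁻¹)))) 0 := by
  have h1 := hasFDerivAt_loadVoltage_uniform hrow hU hred hEs hEN
  have h2 := W.hasFDerivAt_invVoltage (W.zipVoltage 0 0 0)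
  have h := h2.comp (0 : Fin n → ℝ) h1
  refine h.congr_fderiv ?_
  refine ContinuousLinearMap.ext fun q => ?_
  simp only [ContinuousLinearMap.comp_apply, _root_.neg_apply, map_neg, neg_neg,
    LinearMap.coe_toContinuousLinearMap', Matrix.toLin'_apply, Matrix.smul_mulVec,
    Matrix.mulVec_smul, Matrix.mulVec_mulVec, Matrix.mul_assoc]

/-! ## §3 Theorem 4.2: the power-sharing matrix `S_1 = K_I(B_II + K_I)⁻¹B_ILB_red⁻¹` -/

variable (W) in
/-- **The power-sharing matrix** `S_1 = K_I(B_II + K_I)⁻¹B_ILB_red⁻¹ ∈ ℝ^{m×n}` of (4.8).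
[cite: SimpsonporcoDorflerBullo2017, §4.2 Theorem 4.2 eq. (4.8)] -/
def shareMatrix : Matrix (Fin m) (Fin n) ℝ := diagonal W.K * W.BIIK⁻¹ * W.BIL * W.Bred⁻¹

/-- **Theorem 4.2 (Power Sharing), eq. (4.8)**: with constant-power loads and uniform set points
`E_I* = E_N𝟙_m`, `E_N ≠ 0` (and the Theorem 3.1 / 3.3 invertibility data, zero row sums of `B`), the
map `Q_L ↦ Q_I(Q_L) = K_I[E_I](E_I − E_I*)` along the solution branch of Theorem 3.4 has Fréchet
derivative `S_1 = K_I(B_II + K_I)⁻¹B_ILB_red⁻¹` at `Q_L = 0`: `Q_I = S_1Q_L + o(‖Q_L‖)` — the print's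
«`Q_I = K_I(B_II+K_I)⁻¹B_ILB_red⁻¹Q_L`» under «the approximate load voltages (4.7)» / «linearize around
the open-circuit operating condition» (the factors `E_N` of `E_NK_I` and `1/E_N` of `A₁` cancel).
[cite: SimpsonporcoDorflerBullo2017, §4.2 Theorem 4.2 eq. (4.8) (p0014 L36–L41) and its proof (p0014 L75 – p0015 L17)] -/
theorem theorem_4_2_powerSharing (hrow : ∀ k, ∑ k', W.B k k' = 0) (hU : IsUnit W.BIIK.det)
    (hred : IsUnit W.Bred.det) {EN : ℝ} (hEs : W.Estar = fun _ => EN) (hEN : EN ≠ 0) :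
    HasFDerivAt (fun Q i => W.invInjection (W.zipState 0 0 Q) i)
      (LinearMap.toContinuousLinearMap (Matrix.toLin' W.shareMatrix)) 0 := by
  have hv := hasFDerivAt_invVoltage_uniform hrow hU hred hEs hEN
  obtain ⟨-, hI0, -⟩ := openCircuit_uniform hrow hU hred hEs hEN
  set A : (Fin n → ℝ) →L[ℝ] (Fin m → ℝ) := LinearMap.toContinuousLinearMap
    (Matrix.toLin' (EN⁻¹ • (W.BIIK⁻¹ * W.BIL * W.Bred⁻¹))) with hA
  have hvi : ∀ i, HasFDerivAt (fun Q => W.invVoltage (W.zipVoltage 0 0 Q) i)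
      ((ContinuousLinearMap.proj i : (Fin m → ℝ) →L[ℝ] ℝ).comp A) 0 := fun i =>
    hasFDerivAt_pi'.1 hv i
  have hv0 : ∀ i, W.invVoltage (W.zipVoltage 0 0 0) i = EN := fun i => by rw [hI0]
  have hAq : ∀ q i, A q i = EN⁻¹ * ((W.BIIK⁻¹ * W.BIL * W.Bred⁻¹) *ᵥ q) i := fun q i => by
    simp only [hA, LinearMap.coe_toContinuousLinearMap', Matrix.toLin'_apply, Matrix.smul_mulVec,
      Pi.smul_apply, smul_eq_mul]
  have hSq : ∀ q i, (W.shareMatrix *ᵥ q) i = W.K i * ((W.BIIK⁻¹ * W.BIL * W.Bred⁻¹) *ᵥ q) i := by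
    intro q i
    rw [shareMatrix, Matrix.mul_assoc (diagonal W.K), Matrix.mul_assoc (diagonal W.K),
      ← Matrix.mulVec_mulVec, Matrix.mulVec_diagonal]
  set L : (Fin n → ℝ) →L[ℝ] (Fin m → ℝ) :=
    LinearMap.toContinuousLinearMap (Matrix.toLin' W.shareMatrix) with hL
  have key : HasFDerivAt (fun Q i => W.invInjection (W.zipState 0 0 Q) i)
      (ContinuousLinearMap.pi fun i => (ContinuousLinearMap.proj i : (Fin m → ℝ) →L[ℝ] ℝ).comp L)
      0 := by
    refine hasFDerivAt_pi.2 fun i => ?_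
    have h := ((hvi i).const_mul (W.K i)).mul ((hvi i).sub_const (W.Estar i))
    refine (h.congr_of_eventuallyEq (Eventually.of_forall fun Q => ?_)).congr_fderiv ?_
    · simp only [invInjection, zipState, liftState, Sum.elim_inr, Pi.mul_apply]
    · refine ContinuousLinearMap.ext fun q => ?_
      simp only [_root_.smul_apply, ContinuousLinearMap.comp_apply,
        ContinuousLinearMap.proj_apply, LinearMap.coe_toContinuousLinearMap', Matrix.toLin'_apply,
        smul_eq_mul, hv0, hAq, hSq, hEs, hL, sub_self, zero_smul, add_zero]
      field_simp
  exact key.congr_fderiv (ContinuousLinearMap.ext fun q => funext fun i => rfl)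

/-- (4.8) read as `fderiv`: `D(Q_I)(0)q = S_1q`. [cite: SimpsonporcoDorflerBullo2017, §4.2 Theorem 4.2 eq. (4.8)] -/
theorem fderiv_invInjection_zero (hrow : ∀ k, ∑ k', W.B k k' = 0) (hU : IsUnit W.BIIK.det)
    (hred : IsUnit W.Bred.det) {EN : ℝ} (hEs : W.Estar = fun _ => EN) (hEN : EN ≠ 0)
    (q : Fin n → ℝ) :
    fderiv ℝ (fun Q i => W.invInjection (W.zipState 0 0 Q) i) 0 q = W.shareMatrix *ᵥ q := by
  rw [(theorem_4_2_powerSharing hrow hU hred hEs hEN).fderiv]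
  simp [Matrix.toLin'_apply]

/-- **Theorem 4.2 (4.8) from network data**: connected inductive network `B = susceptanceMatrix w`
(`w` symmetric, `≥ 0`, `BranchConnected w`), at least one inverter, gains `K_i < 0`, uniform set points
`E_I* = E_N𝟙_m` with `E_N > 0` — then `B` has zero row sums, `B_II + K_I` and `B_red` are invertible
(Lemma 7.1, Proposition 7.2 (i)), and (4.8) holds as a derivative at `Q_L = 0`.
[cite: SimpsonporcoDorflerBullo2017, §4.2 Theorem 4.2 eq. (4.8) with §7 Lemma 7.1 and Proposition 7.2] -/
theorem theorem_4_2_powerSharing_of_network {w : Fin n ⊕ Fin m → Fin n ⊕ Fin m → ℝ}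
    (hw : ∀ i j, w i j = w j i) (hw0 : ∀ i j, 0 ≤ w i j) (hconn : BranchConnected w)
    (hBw : W.B = susceptanceMatrix w) (hK : ∀ i, W.K i < 0) (hm : 0 < m) {EN : ℝ} (hEN : 0 < EN)
    (hEs : W.Estar = fun _ => EN) :
    HasFDerivAt (fun Q i => W.invInjection (W.zipState 0 0 Q) i)
      (LinearMap.toContinuousLinearMap (Matrix.toLin' W.shareMatrix)) 0 := by
  have hB : W.B.IsSymm := by rw [hBw]; exact susceptanceMatrix_isSymm hw
  have hoff : ∀ k k', k ≠ k' → 0 ≤ W.B k k' := fun k k' hkk' => by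
    rw [hBw]; exact susceptanceMatrix_offDiag_nonneg hw0 hkk'
  have hrow : ∀ k, ∑ k', W.B k k' = 0 := fun k => by
    rw [hBw]; exact sum_susceptanceMatrix_row w k
  have hM := posDef_neg_aug_of_branchConnected hw hw0 hconn hBw hK hm
  have hU : IsUnit W.BIIK.det := isUnit_BIIK_det_of_posDef (posDef_neg_BIIK_of_posDef_aug hM)
  have hEs' : ∀ i, 0 < W.Estar i := fun i => by rw [hEs]; exact hEN
  obtain ⟨⟨hred, -⟩, -, -, -⟩ := proposition_7_2 hB hoff hrow hM (fun i => (hK i).le) hEs'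
  exact theorem_4_2_powerSharing hrow hU (isUnit_det_of_posDef_neg₄ hred) hEs hEN.ne'

/-! ## §4 The high-gain limit: `S_ε → B_ILB_LL⁻¹` and distance-based sharing (4.9) -/

variable (W) in
/-- `B_red,ε = B_LL − B_LI(B_II + εK_I)⁻¹B_IL`. [cite: SimpsonporcoDorflerBullo2017, proof of Theorem 4.2 (p0015 L19)] -/
def BredGain (ε : ℝ) : Matrix (Fin n) (Fin n) ℝ :=
  W.BLL - W.BLI * (W.BII + ε • diagonal W.K)⁻¹ * W.BIL

variable (W) in
/-- `S_ε = εK_I(B_II + εK_I)⁻¹B_ILB_red,ε⁻¹` — the power-sharing matrix with all gains scaled by `ε`.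
[cite: SimpsonporcoDorflerBullo2017, proof of Theorem 4.2 (p0015 L21)] -/
def shareMatrixGain (ε : ℝ) : Matrix (Fin m) (Fin n) ℝ :=
  (ε • diagonal W.K) * (W.BII + ε • diagonal W.K)⁻¹ * W.BIL * (W.BredGain ε)⁻¹

/-- `B_red,1 = B_red`. [cite: SimpsonporcoDorflerBullo2017, proof of Theorem 4.2 («for `ε = 1`, we recover the previously derived formula»)] -/
theorem BredGain_one : W.BredGain 1 = W.Bred := by
  rw [BredGain, one_smul, Bred, BIIK]

/-- `S_1` is the matrix of (4.8). [cite: SimpsonporcoDorflerBullo2017, proof of Theorem 4.2 («Note that for `ε = 1`, we recover the previously derived formula (4.8) as `Q_I = S_1Q_L`», p0015 L23)] -/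
theorem shareMatrixGain_one : W.shareMatrixGain 1 = W.shareMatrix := by
  rw [shareMatrixGain, BredGain_one, one_smul, shareMatrix, BIIK]

/-- The rescaled form used in the limit: for `ε ≠ 0` with `ε⁻¹B_II + K_I` invertible,
`(B_II + εK_I)⁻¹ = ε⁻¹(ε⁻¹B_II + K_I)⁻¹`. [cite: SimpsonporcoDorflerBullo2017, proof of Theorem 4.2 («`lim_{ε→∞} εK_I(B_II+εK_I)⁻¹ = I_m`», p0015 L24–L25)] -/
theorem inv_BII_add_smul {ε : ℝ} (hε : ε ≠ 0)
    (hN : IsUnit (ε⁻¹ • W.BII + diagonal W.K).det) :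
    (W.BII + ε • diagonal W.K)⁻¹ = ε⁻¹ • (ε⁻¹ • W.BII + diagonal W.K)⁻¹ := by
  have hfac : W.BII + ε • diagonal W.K = ε • (ε⁻¹ • W.BII + diagonal W.K) := by
    rw [smul_add, smul_smul, mul_inv_cancel₀ hε, one_smul]
  rw [hfac]
  refine inv_eq_right_inv ?_
  rw [Matrix.smul_mul, Matrix.mul_smul, smul_smul, mul_nonsing_inv _ hN, mul_inv_cancel₀ hε, one_smul]

/-- The rescaled sharing matrix: for `ε ≠ 0` with `ε⁻¹B_II + K_I` invertible,
`S_ε = K_I(ε⁻¹B_II + K_I)⁻¹B_IL(B_LL − ε⁻¹B_LI(ε⁻¹B_II + K_I)⁻¹B_IL)⁻¹` — continuous across `ε⁻¹ = 0`.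
[cite: SimpsonporcoDorflerBullo2017, proof of Theorem 4.2 1) (p0015 L19–L30)] -/
theorem shareMatrixGain_eq_rescaled {ε : ℝ} (hε : ε ≠ 0)
    (hN : IsUnit (ε⁻¹ • W.BII + diagonal W.K).det) :
    W.shareMatrixGain ε = diagonal W.K * (ε⁻¹ • W.BII + diagonal W.K)⁻¹ * W.BIL *
      (W.BLL - ε⁻¹ • (W.BLI * (ε⁻¹ • W.BII + diagonal W.K)⁻¹ * W.BIL))⁻¹ := by
  rw [shareMatrixGain, BredGain, inv_BII_add_smul hε hN]
  congr 2
  · rw [Matrix.mul_smul, Matrix.smul_mul, smul_smul, inv_mul_cancel₀ hε, one_smul]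
  · rw [Matrix.mul_smul, Matrix.smul_mul]

/-- The limit of the rescaled expression: `K_I(ε⁻¹B_II + K_I)⁻¹B_IL(B_LL − ε⁻¹B_LI(ε⁻¹B_II + K_I)⁻¹B_IL)⁻¹ → B_ILB_LL⁻¹`
(«`lim B_red,ε = B_LL`, `lim εK_I(B_II + εK_I)⁻¹ = I_m`»; continuity of the matrix inverse at `K_I` and
at `B_LL`). [cite: SimpsonporcoDorflerBullo2017, proof of Theorem 4.2 1) (p0015 L24–L30)] -/
theorem tendsto_rescaled_atTop (hK : ∀ i, W.K i ≠ 0) (hLL : IsUnit W.BLL.det) :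
    Tendsto (fun ε : ℝ => diagonal W.K * (ε⁻¹ • W.BII + diagonal W.K)⁻¹ * W.BIL *
      (W.BLL - ε⁻¹ • (W.BLI * (ε⁻¹ • W.BII + diagonal W.K)⁻¹ * W.BIL))⁻¹) atTop
      (𝓝 (W.BIL * W.BLL⁻¹)) := by
  have hKu : (diagonal W.K).det ≠ 0 := by
    rw [det_diagonal]
    exact Finset.prod_ne_zero_iff.2 fun i _ => hK i
  have hKunit : IsUnit (diagonal W.K).det := isUnit_iff_ne_zero.2 hKu
  -- `ε⁻¹ → 0`, hence `ε⁻¹B_II + K_I → K_I`, its inverse `→ K_I⁻¹`, `K_I(ε⁻¹B_II + K_I)⁻¹ → I_m`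
  have hinv : Tendsto (fun ε : ℝ => ε⁻¹) atTop (𝓝 0) := tendsto_inv_atTop_zero
  have hN : Tendsto (fun ε : ℝ => ε⁻¹ • W.BII + diagonal W.K) atTop (𝓝 (diagonal W.K)) := by
    have h : Tendsto (fun ε : ℝ => ε⁻¹ • W.BII + diagonal W.K) atTop
        (𝓝 ((0 : ℝ) • W.BII + diagonal W.K)) :=
      (hinv.smul tendsto_const_nhds).add tendsto_const_nhds
    rwa [zero_smul, zero_add] at h
  have hNinv : Tendsto (fun ε : ℝ => (ε⁻¹ • W.BII + diagonal W.K)⁻¹) atTop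
      (𝓝 (diagonal W.K)⁻¹) := by
    have hc : ContinuousAt Inv.inv (diagonal W.K) := by
      refine continuousAt_matrix_inv _ ?_
      rw [Ring.inverse_eq_inv']
      exact continuousAt_inv₀ hKu
    exact hc.tendsto.comp hN
  have hKN : Tendsto (fun ε : ℝ => diagonal W.K * (ε⁻¹ • W.BII + diagonal W.K)⁻¹) atTop
      (𝓝 (1 : Matrix (Fin m) (Fin m) ℝ)) := by
    have hcK : Continuous fun N : Matrix (Fin m) (Fin m) ℝ => diagonal W.K * N :=
      continuous_const.matrix_mul continuous_id
    have h : Tendsto (fun ε : ℝ => diagonal W.K * (ε⁻¹ • W.BII + diagonal W.K)⁻¹) atTop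
        (𝓝 (diagonal W.K * (diagonal W.K)⁻¹)) := (hcK.tendsto _).comp hNinv
    rwa [mul_nonsing_inv _ hKunit] at h
  -- `B_red,ε = B_LL − ε⁻¹B_LI(ε⁻¹B_II + K_I)⁻¹B_IL → B_LL`, and its inverse `→ B_LL⁻¹`
  have hP : Tendsto (fun ε : ℝ => W.BLI * (ε⁻¹ • W.BII + diagonal W.K)⁻¹ * W.BIL) atTop
      (𝓝 (W.BLI * (diagonal W.K)⁻¹ * W.BIL)) := by
    have hc3 : Continuous fun N : Matrix (Fin m) (Fin m) ℝ => W.BLI * N * W.BIL :=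
      (continuous_const.matrix_mul continuous_id).matrix_mul continuous_const
    exact (hc3.tendsto _).comp hNinv
  have hR : Tendsto (fun ε : ℝ => W.BLL - ε⁻¹ • (W.BLI * (ε⁻¹ • W.BII + diagonal W.K)⁻¹ * W.BIL))
      atTop (𝓝 W.BLL) := by
    have h : Tendsto (fun ε : ℝ => W.BLL - ε⁻¹ • (W.BLI * (ε⁻¹ • W.BII + diagonal W.K)⁻¹ * W.BIL))
        atTop (𝓝 (W.BLL - (0 : ℝ) • (W.BLI * (diagonal W.K)⁻¹ * W.BIL))) :=
      tendsto_const_nhds.sub (hinv.smul hP)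
    rwa [zero_smul, sub_zero] at h
  have hRinv : Tendsto
      (fun ε : ℝ => (W.BLL - ε⁻¹ • (W.BLI * (ε⁻¹ • W.BII + diagonal W.K)⁻¹ * W.BIL))⁻¹) atTop
      (𝓝 W.BLL⁻¹) := by
    have hc : ContinuousAt Inv.inv W.BLL := by
      refine continuousAt_matrix_inv _ ?_
      rw [Ring.inverse_eq_inv']
      exact continuousAt_inv₀ hLL.ne_zero
    exact hc.tendsto.comp hR
  have hc4 : Continuous fun p : Matrix (Fin m) (Fin m) ℝ × Matrix (Fin n) (Fin n) ℝ =>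
      p.1 * W.BIL * p.2 :=
    (continuous_fst.matrix_mul continuous_const).matrix_mul continuous_snd
  have hpair := hKN.prodMk_nhds hRinv
  have h0 := (hc4.tendsto ((1 : Matrix (Fin m) (Fin m) ℝ), W.BLL⁻¹)).comp hpair
  rw [Function.comp_def] at h0
  simp only [Matrix.one_mul] at h0
  exact h0

/-- **Theorem 4.2 1), the high-gain limit of the sharing matrices**: if every `K_i ≠ 0` and `B_LL` is
invertible, then `S_ε = εK_I(B_II + εK_I)⁻¹B_ILB_red,ε⁻¹ → B_ILB_LL⁻¹` as `ε → ∞`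
(«`lim B_red,ε = B_LL`, `lim εK_I(B_II + εK_I)⁻¹ = I_m`»).
[cite: SimpsonporcoDorflerBullo2017, §4.2 Theorem 4.2 1) and its proof («It follows that `lim_{ε→∞} S_ε = B_ILB_LL⁻¹`», p0015 L19–L30)] -/
theorem tendsto_shareMatrixGain_atTop (hK : ∀ i, W.K i ≠ 0) (hLL : IsUnit W.BLL.det) :
    Tendsto W.shareMatrixGain atTop (𝓝 (W.BIL * W.BLL⁻¹)) := by
  have hKu : (diagonal W.K).det ≠ 0 := by
    rw [det_diagonal]
    exact Finset.prod_ne_zero_iff.2 fun i _ => hK i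
  -- eventually `S_ε` equals the rescaled expression: `ε > 0` and `det(ε⁻¹B_II + K_I) ≠ 0`
  have hN : Tendsto (fun ε : ℝ => ε⁻¹ • W.BII + diagonal W.K) atTop (𝓝 (diagonal W.K)) := by
    have h : Tendsto (fun ε : ℝ => ε⁻¹ • W.BII + diagonal W.K) atTop
        (𝓝 ((0 : ℝ) • W.BII + diagonal W.K)) :=
      (tendsto_inv_atTop_zero.smul tendsto_const_nhds).add tendsto_const_nhds
    rwa [zero_smul, zero_add] at h
  have hdet : Tendsto (fun ε : ℝ => (ε⁻¹ • W.BII + diagonal W.K).det) atTop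
      (𝓝 (diagonal W.K).det) :=
    (continuous_id.matrix_det.tendsto _).comp hN
  have hev : ∀ᶠ ε in atTop, (ε⁻¹ • W.BII + diagonal W.K).det ≠ 0 := hdet.eventually_ne hKu
  refine (tendsto_rescaled_atTop hK hLL).congr' ?_
  filter_upwards [hev, eventually_gt_atTop (0 : ℝ)] with ε hε hpos
  exact (shareMatrixGain_eq_rescaled hpos.ne' (isUnit_iff_ne_zero.2 hε)).symm

variable (W) in
/-- **Differential effective reactances** `X^eff = −B_LL⁻¹` (Definition 1, computed in the proof of
Lemma 7.3: «from the current balance equations `−jI_L = B_LLE_L + B_LIE_I` … `E_L^oc = −B_LL⁻¹B_LIE_I`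
… `E_L − E_L^oc = −jB_LL⁻¹I_L`, and it follows that `X^eff = −B_LL⁻¹`»); the defining property is
`Xeff_spec`. [cite: SimpsonporcoDorflerBullo2017, §4.2 Definition 1 (p0014 L26–L30) and §7 proof of Lemma 7.3 (p0019 L78–L80)] -/
def Xeff : Matrix (Fin n) (Fin n) ℝ := -W.BLL⁻¹

/-- **Definition 1 as a theorem** for the linear current-balance model of the load buses with the
inverter voltages held fixed, `ι_L = B_LLE_L + B_LIE_I` (`ι = −jI`, real): the open-circuit voltages
(`ι_L = 0`) are `E^oc = −B_LL⁻¹B_LIE_I`, and if a unit current is EXTRACTED at load `j` (`ι_L = −e_j`)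
with all other load currents zero, the resulting load voltages satisfy `E_i − E_i^oc = X^eff_ij`.
[cite: SimpsonporcoDorflerBullo2017, §4.2 Definition 1 and §7 proof of Lemma 7.3 (p0019 L78–L80)] -/
theorem Xeff_spec (hLL : IsUnit W.BLL.det) (EI : Fin m → ℝ) (j : Fin n) {E Eoc : Fin n → ℝ}
    (hoc : W.BLL *ᵥ Eoc + W.BLI *ᵥ EI = 0)
    (hE : W.BLL *ᵥ E + W.BLI *ᵥ EI = -Pi.single j 1) (i : Fin n) :
    E i - Eoc i = W.Xeff i j := by
  have hdiff : W.BLL *ᵥ (E - Eoc) = -Pi.single j 1 := by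
    rw [Matrix.mulVec_sub]
    have : W.BLL *ᵥ E = -Pi.single j 1 - W.BLI *ᵥ EI := eq_sub_of_add_eq hE
    have h2 : W.BLL *ᵥ Eoc = -(W.BLI *ᵥ EI) := eq_neg_of_add_eq_zero_left hoc
    rw [this, h2]; abel
  have hsol : E - Eoc = W.BLL⁻¹ *ᵥ (-Pi.single j 1) := by
    rw [← hdiff, Matrix.mulVec_mulVec, nonsing_inv_mul _ hLL, Matrix.one_mulVec]
  have h := congrFun hsol i
  rw [Pi.sub_apply] at h
  rw [h, Xeff, Matrix.mulVec_neg, Pi.neg_apply, Matrix.mulVec_single_one, Matrix.col_apply,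
    Matrix.neg_apply]

/-- **Lemma 7.3 (Electrical Distances)**: `−(B_ILB_LL⁻¹)_ij = Σ_{k∈L} X^eff_kj/X_ik` with `1/X_ik = B_ik`
(the direct susceptance, `0` when `{i,k}` is not a branch).
[cite: SimpsonporcoDorflerBullo2017, §7 Lemma 7.3 (p0019 L72–L76) and its proof (L78–L80)] -/
theorem lemma_7_3 (i : Fin m) (j : Fin n) :
    -(W.BIL * W.BLL⁻¹) i j = ∑ k, W.BIL i k * W.Xeff k j := by
  simp only [Xeff, Matrix.neg_apply, Matrix.mul_apply, Finset.sum_neg_distrib, mul_neg]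

/-- **Theorem 4.2 1) (Distance-Based Power Sharing), entrywise**: the limiting sharing coefficient of
inverter `i` with respect to the demand at load `j` is `−Σ_{k∈L} B_ik X^eff_kj = −Σ_k (1/X_ik)Σ… ` —
(4.9) `Q_i = −Σ_{k∈L}(1/X_ik)Σ_{j∈L}X^eff_kjQ_j` read coefficient by coefficient («loads are
preferentially supplied with power by sources which are electrically nearby»).
[cite: SimpsonporcoDorflerBullo2017, §4.2 Theorem 4.2 1) eq. (4.9) (p0014 L45–L52) with Lemma 7.3] -/
theorem tendsto_shareMatrixGain_atTop_distance (hK : ∀ i, W.K i ≠ 0) (hLL : IsUnit W.BLL.det)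
    (i : Fin m) (j : Fin n) :
    Tendsto (fun ε => W.shareMatrixGain ε i j) atTop (𝓝 (-∑ k, W.BIL i k * W.Xeff k j)) := by
  have hval : (W.BIL * W.BLL⁻¹) i j = -∑ k, W.BIL i k * W.Xeff k j := by
    rw [← lemma_7_3, neg_neg]
  have hc : Continuous fun S : Matrix (Fin m) (Fin n) ℝ => S i j :=
    (continuous_apply j).comp (continuous_apply i)
  have h := (hc.tendsto _).comp (tendsto_shareMatrixGain_atTop hK hLL)
  rw [hval] at h
  exact h

/-- The limiting response in vector form: `S_εQ_L → B_ILB_LL⁻¹Q_L`, i.e. for each inverter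
`(S_εQ_L)_i → −Σ_k B_ik Σ_j X^eff_kj Q_j` (4.9). [cite: SimpsonporcoDorflerBullo2017, §4.2 Theorem 4.2 1) eq. (4.9)] -/
theorem tendsto_shareMatrixGain_mulVec_atTop (hK : ∀ i, W.K i ≠ 0) (hLL : IsUnit W.BLL.det)
    (Q : Fin n → ℝ) (i : Fin m) :
    Tendsto (fun ε => (W.shareMatrixGain ε *ᵥ Q) i) atTop
      (𝓝 (-∑ k, W.BIL i k * ∑ j, W.Xeff k j * Q j)) := by
  have hlim : Tendsto (fun ε => (W.shareMatrixGain ε *ᵥ Q) i) atTop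
      (𝓝 (((W.BIL * W.BLL⁻¹) *ᵥ Q) i)) := by
    have hc : Continuous fun S : Matrix (Fin m) (Fin n) ℝ => (S *ᵥ Q) i :=
      (continuous_apply i).comp (continuous_id.matrix_mulVec continuous_const)
    exact (hc.tendsto _).comp (tendsto_shareMatrixGain_atTop hK hLL)
  have hval : ((W.BIL * W.BLL⁻¹) *ᵥ Q) i = -∑ k, W.BIL i k * ∑ j, W.Xeff k j * Q j := by
    simp only [Matrix.mulVec, dotProduct, Matrix.mul_apply, Xeff, Matrix.neg_apply, Finset.sum_mul,
      Finset.mul_sum, neg_mul, mul_neg, Finset.sum_neg_distrib, neg_neg, mul_assoc]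
    rw [Finset.sum_comm]
  rw [hval] at hlim
  exact hlim

end QuadDroopNetwork

end Literature.MathematicalPhysics.PowerSystems
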